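import Summits.AtomisticToContinuum.HydrodynamicLimit.Theses.CollisionIsometryCLT
import Summits.AtomisticToContinuum.HydrodynamicLimit.Theorems.CorrectorPressureDecay.Negative.FreeFlow
import Summits.AtomisticToContinuum.HydrodynamicLimit.Theorems.AprioriBounds.Negative.AdmissibleKernel
import Summits.AtomisticToContinuum.HydrodynamicLimit.Theorems.AprioriBounds.Negative.BlockDensityAveraging
import Literature.Analysis.FluidPDE.HardSphereAlexander
import Literature.MathematicalPhysics.KineticTheory.HardSphereEulerProofs

/-!
# Disproof of `FastMomentRelaxation` (stmt-AtomisticToContinuum-9522) — findings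

Standing disprover's work file (refuter-cdisprove-stmt-AtomisticToContinuum-9522-0) for the crux
`CollisionIsometryCLT.FastMomentRelaxation` (shared verbatim with `StiffCollisionalRelaxation`):
for continuous profiles `a₀, θ₀ > 0`, `u₀`, `∃ σ₀ ∀ σ ∈ (0, σ₀) ∀ flow families ∀ admissible kernel families
∀ t > 0 ∀ δ > 0`, the local-Gibbs probability that `∫₀ᵗ∫ₓ |D|² + |q|² > δ` tends to `0`, where `D` is the block
traceless central kinetic stress and `q` the block central kinetic heat flux of the deterministically evolved gas.

## Findings (indexed; prose only in docstrings)

* **No kill.**  Every junk regime of the typed statement is PRO-TRUTH (measure `0`, or an empty event), never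
  pro-falsity: non-integrable observables are Bochner-junk `0 < δ`; flows off the conull good set are invisible to
  the Liouville-absolutely-continuous law; `t ≤ 0`, `δ ≤ 0`… see §0.  A substantive kill would need an `N`-uniform
  NON-relaxation statement for deterministic hard spheres at fixed `σ > 0`, whose mean free path
  `(N+1)^{-1/3} σ⁻²` vanishes: none is in print or in reach (§3).
* **(a) load-bearing hypotheses.**
  - `0 < δ` is load-bearing, trivially: `fastMomentRelaxation_false_without_delta_pos` (§1; the observable is
    `≥ 0`, the laws are probability measures for `σ ≤ 1/2`).
  - `0 < σ` (COLLISIONS) is load-bearing, substantively: `fastMomentRelaxation_false_without_sigma_pos` (§2).  At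
    `σ = 0` the crux's flow type is inhabited by the FREE gas (`freeFlow₀`, tree) and the local Gibbs law of the
    shear profile `a₀ = θ₀ = 1`, `u₀ = U sin(2π x₂) e₁` phase-mixes its bulk shear energy `U²/4` into a PERSISTENT
    anisotropic kinetic stress: the global velocity covariance `T = (N+1)⁻¹ Σ vᵢ ⊗ vᵢ` is conserved by free flight
    with `T₁₁ - T₂₂ → U²/2`, while the block bulk energy `∫ₓ ρ̄ ū₁²` decays like `U² e^{-4π²s²}` (Gaussian
    characteristic function) — and `∫ₓ D₁₁ dx ≥ ⅔T₁₁ - ⅓(T₂₂ + T₃₃) - ⅔∫ₓ ρ̄ū₁²` deterministically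
    (`integral_D11_ge`, §2a).  Hence `∫₀ᵗ∫ₓ |D|² ≥ (∫₀ᵗ∫ₓ D₁₁)²/t ≥ c(U,t) > 0` with probability bounded below.
    ANY PROOF OF THE CRUX MUST USE THE COLLISIONS QUANTITATIVELY (a relaxation RATE beating the phase-mixing clock),
    not merely the invariance of the local Gibbs structure.
  - `0 < γ` / the support clause: at `γ = 0` the constant kernel `φ ≡ 1` is admissible and `D` becomes the GLOBAL
    deviator in the momentum rest frame, which counts the bulk shear energy `U²/2·(e₁⊗e₁)` of a stationary Euler
    shear flow: false granted ANY persistence of the shear (heuristic only — needs the true dynamics; §3).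
  - `γ ≤ 1/15` is NOT needed for truth up to `γ < 1/3`; for `γ > 1/3` the blocks are smaller than a particle
    (`(N+1)^{-γ} ≪ hsDiameter σ N`), hold `≤ 1` centre, and `D = q = 0` identically: the statement turns TRIVIALLY
    true there (§3, note for provers: the honest range is `0 < γ < 1/3`).
* **(b) what must relax.**  By `integral_D11_ge` the crux IMPLIES global equipartition of peculiar kinetic energy
  in time `o(1)`: `limsup P(∫₀ᵗ [⅔T₁₁ - ⅓(T₂₂+T₃₃) - ⅔∫ₓρ̄ū₁²](s) ds > η) = 0` for every `η > 0` — a necessary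
  condition provers can aim at first (it only involves one-body velocity moments).
* **(c) strengthenings.**  Uniformity in `σ ∈ (0, σ₀)` is false (near-miss §4: `σ → 0` at fixed `N` recovers the
  free gas on the no-collision set); `sup_{s ≤ t}` instead of `L²_s`, or pointwise-in-`x` versions, are exposed to
  the initial layer `s ≲ mfp` and to shocks respectively (not typed here).

All `[folklore]`.
-/

noncomputable section

open MeasureTheory Filter Set Topology Function
open scoped ENNReal Topology BigOperators

namespace Summit.AtomisticToContinuum.HydrodynamicLimit.Cruxes.FastMomentRelaxation.Disproof

open Literature.MathematicalPhysics.KineticTheory Literature.Analysis.FluidPDE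
open Summit.AtomisticToContinuum.HydrodynamicLimit.Theorems.AprioriBoundsNegative
  (exists_admissibleKernelFamily integral_blockDensity integrable_blockDensity blockDensity_eq
    not_tendsto_zero_of_frequently_univ)
open Summit.AtomisticToContinuum.HydrodynamicLimit.Theorems.CorrectorPressureDecayNegative.FreeFlow
  (freeFlow₀ freeFlow_flow hsDiameter_zero)

/-! ## §0 The crux, and generic tools -/

/-- The crux under disproof (an abbreviation, for the record). -/
abbrev Crux : Prop := Summit.AtomisticToContinuum.HydrodynamicLimit.Theses.CollisionIsometryCLT.FastMomentRelaxation

/-- A sequence in `ℝ≥0∞` that is constantly `1` does not tend to `0`. [folklore] -/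
theorem not_tendsto_zero_of_forall_eq_one {f : ℕ → ℝ≥0∞} (hf : ∀ N, f N = 1) :
    ¬ Tendsto f atTop (𝓝 0) := by
  intro h
  have hev : ∀ᶠ N in atTop, f N < 1 := h.eventually (gt_mem_nhds (by norm_num))
  obtain ⟨N, hN⟩ := hev.exists
  rw [hf N] at hN
  exact lt_irrefl _ hN

/-- A sequence in `ℝ≥0∞` frequently `≥ c > 0` does not tend to `0`. [folklore] -/
theorem not_tendsto_zero_of_frequently_le {f : ℕ → ℝ≥0∞} {c : ℝ≥0∞} (hc : 0 < c)
    (hf : ∃ᶠ N in atTop, c ≤ f N) : ¬ Tendsto f atTop (𝓝 0) := by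
  intro h
  have hev : ∀ᶠ N in atTop, f N < c := h.eventually (gt_mem_nhds hc)
  obtain ⟨N, hN1, hN2⟩ := (hf.and_eventually hev).exists
  exact absurd hN2 (not_lt.2 hN1)

/-! ## §1 `0 < δ` is load-bearing (trivially) -/

/-- The crux with the hypothesis `0 < δ` DROPPED (everything else verbatim). -/
def FastMomentRelaxationWithoutDeltaPos : Prop :=
  ∀ (a₀ θ₀ : (UnitAddTorus (Fin 3)) → ℝ) (u₀ : (UnitAddTorus (Fin 3)) → (EuclideanSpace ℝ (Fin 3))), Continuous a₀ → Continuous θ₀ → Continuous u₀ → (∀ x, 0 < a₀ x) → (∀ x, 0 < θ₀ x) → ∃ σ₀ : ℝ, 0 < σ₀ ∧ ∀ σ : ℝ, 0 < σ → σ < σ₀ → ∀ Φ : (N : ℕ) → Literature.Analysis.FluidPDE.HardSphereFlow (Literature.Analysis.FluidPDE.Torus.geometry (Fin 3)) (Literature.MathematicalPhysics.KineticTheory.hsDiameter σ N) (N + 1), ∀ (γ C : ℝ) (φ : ℕ → (UnitAddTorus (Fin 3)) → ℝ), 0 < γ → γ ≤ 1 / 15 → ((∀ N, Literature.Analysis.FunctionSpaces.Torus.IsSmooth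 (φ N)) ∧ (∀ N y, 0 ≤ φ N y) ∧ (∀ N, ∫ y, φ N y = 1) ∧ (∀ (N : ℕ) y, ((N : ℝ) + 1) ^ (-γ) ≤ Literature.Analysis.FluidPDE.Torus.euclidDist y 0 → φ N y = 0) ∧ (∀ (N : ℕ) y, φ N y ≤ C * ((N : ℝ) + 1) ^ (3 * γ)) ∧ (∀ (N : ℕ) y, ‖Literature.Analysis.FunctionSpaces.Torus.gradient (φ N) y‖ ≤ C * ((N : ℝ) + 1) ^ (4 * γ))) → let ρb := fun (N : ℕ) (z : Literature.Analysis.FluidPDE.Config (N + 1) (Fin 3) (UnitAddTorus (Fin 3))) (x : (UnitAddTorus (Fin 3))) => Literature.MathematicalPhysics.KineticTheory.empiricalDensityField z (fun y => φ N (y - x)); let mb := fun (N : ℕ) (z : Literature.Analysis.FluidPDE.Config (N + 1) (Fin 3) (UnitAddTorus (Fin 3))) (x : (UnitAddTorus (Fin 3))) => Literature.MathematicalPhysics.KineticTheory.empiricalMomentumField z (fun y => φ N (y - x)); let ub := fun (N : ℕ) (z : Literature.Analysis.FluidPDE.Config (N + 1) (Fin 3) (UnitAddTorus (Fin 3)))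 (x : (UnitAddTorus (Fin 3))) => (ρb N z x)⁻¹ • mb N z x; let D := fun (N : ℕ) (z : Literature.Analysis.FluidPDE.Config (N + 1) (Fin 3) (UnitAddTorus (Fin 3))) (x : (UnitAddTorus (Fin 3))) (j k : Fin 3) => (∫ y, φ N (y.1 - x) * ((y.2 j - ub N z x j) * (y.2 k - ub N z x k)) ∂(Literature.Analysis.FluidPDE.empiricalMeasure z)) - (if j = k then (∑ l : Fin 3, ∫ y, φ N (y.1 - x) * (y.2 l - ub N z x l) ^ 2 ∂(Literature.Analysis.FluidPDE.empiricalMeasure z)) / 3 else 0); let q := fun (N : ℕ) (z : Literature.Analysis.FluidPDE.Config (N + 1) (Fin 3) (UnitAddTorus (Fin 3))) (x : (UnitAddTorus (Fin 3))) => ∫ y, (φ N (y.1 - x) * ‖y.2 - ub N z x‖ ^ 2 / 2) • (y.2 - ub N z x) ∂(Literature.Analysis.FluidPDE.empiricalMeasure z); ∀ t : ℝ, 0 < t → ∀ δ : ℝ, Tendsto (fun N : ℕ => Literature.MathematicalPhysics.KineticTheory.localGibbsLaw σ a₀ u₀ θ₀ N (Φ N) {z | δ < ∫ s in Icc 0 t,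 ∫ x, ((∑ j, ∑ k, D N ((Φ N).flow s z) x j k ^ 2) + ‖q N ((Φ N).flow s z) x‖ ^ 2)}) atTop (𝓝 0)

/-- **`0 < δ` is load-bearing.**  Witness: homogeneous profile `a₀ = θ₀ = 1, u₀ = 0`; given `σ₀`, take
`σ = min (σ₀/2) (1/4)`, Alexander's flows (`hsDiameter σ N ≤ σ < 1/2`), the torus-mollifier kernel family,
`t = 1`, `δ = -1`: the observable `∫₀ᵗ∫ₓ |D|² + |q|²` is `≥ 0` (also when Bochner-junk), so the event is ALL of
phase space and has probability `1` for every `N` (the local Gibbs laws are probability measures for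
`σ ≤ 1/2`). [folklore] -/
theorem fastMomentRelaxation_false_without_delta_pos : ¬ FastMomentRelaxationWithoutDeltaPos := by
  intro h
  obtain ⟨σ₀, hσ₀, h⟩ := h (fun _ => 1) (fun _ => 1) (fun _ => 0) continuous_const continuous_const
    continuous_const (fun _ => one_pos) (fun _ => one_pos)
  set σ : ℝ := min (σ₀ / 2) (1 / 4) with hσdef
  have hσ : 0 < σ := lt_min (by linarith) (by norm_num)
  have hσlt : σ < σ₀ := lt_of_le_of_lt (min_le_left _ _) (by linarith)
  have hσ4 : σ ≤ 1 / 4 := min_le_right _ _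
  have hσ2 : σ ≤ 1 / 2 := hσ4.trans (by norm_num)
  have hεlt : ∀ N : ℕ, hsDiameter σ N < 2⁻¹ := fun N =>
    lt_of_le_of_lt (hsDiameter_le hσ.le N) (by linarith)
  set Φ : (N : ℕ) → HardSphereFlow (Torus.geometry (Fin 3)) (hsDiameter σ N) (N + 1) :=
    fun N => (HardSphereFlow.nonempty_torus_holds (hsDiameter_pos hσ N) (hεlt N) (N + 1)).some with hΦ
  obtain ⟨γ, C, φ, hγ, hγ', hsm, hnn, hone, hsupp, hsup, hgrad, -⟩ := exists_admissibleKernelFamily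
  have hT := h σ hσ hσlt Φ γ C φ hγ hγ' ⟨hsm, hnn, hone, hsupp, hsup, hgrad⟩ 1 one_pos (-1)
  refine absurd hT (not_tendsto_zero_of_forall_eq_one fun N => ?_)
  haveI : IsProbabilityMeasure (localGibbsLaw σ (fun _ => 1) (fun _ => 0) (fun _ => 1) N (Φ N)) :=
    isProbabilityMeasure_localGibbsLaw continuous_const continuous_const continuous_const
      (fun _ => one_pos) (fun _ => one_pos) hσ2 N (Φ N)
  dsimp only
  rw [← measure_univ (μ := localGibbsLaw σ (fun _ => 1) (fun _ => 0) (fun _ => 1) N (Φ N))]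
  congr 1
  refine eq_univ_of_forall fun z => ?_
  simp only [mem_setOf_eq]
  refine lt_of_lt_of_le (by norm_num) (integral_nonneg fun s => integral_nonneg fun x => ?_)
  positivity

/-! ## §2 `0 < σ` is load-bearing: the free gas does not relax -/

/-- The crux with the hypothesis `0 < σ` DROPPED (everything else verbatim): `σ = 0`, the free gas, is
then admitted (`hsDiameter 0 N = 0`, flow type inhabited by `freeFlow₀`). -/
def FastMomentRelaxationWithoutSigmaPos : Prop :=
  ∀ (a₀ θ₀ : (UnitAddTorus (Fin 3)) → ℝ) (u₀ : (UnitAddTorus (Fin 3)) → (EuclideanSpace ℝ (Fin 3))), Continuous a₀ → Continuous θ₀ → Continuous u₀ → (∀ x, 0 < a₀ x) → (∀ x, 0 < θ₀ x) → ∃ σ₀ : ℝ, 0 < σ₀ ∧ ∀ σ : ℝ, σ < σ₀ → ∀ Φ : (N : ℕ) → Literature.Analysis.FluidPDE.HardSphereFlow (Literature.Analysis.FluidPDE.Torus.geometry (Fin 3)) (Literature.MathematicalPhysics.KineticTheory.hsDiameter σ N) (N + 1), ∀ (γ C : ℝ) (φ : ℕ → (UnitAddTorus (Fin 3)) → ℝ),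 0 < γ → γ ≤ 1 / 15 → ((∀ N, Literature.Analysis.FunctionSpaces.Torus.IsSmooth (φ N)) ∧ (∀ N y, 0 ≤ φ N y) ∧ (∀ N, ∫ y, φ N y = 1) ∧ (∀ (N : ℕ) y, ((N : ℝ) + 1) ^ (-γ) ≤ Literature.Analysis.FluidPDE.Torus.euclidDist y 0 → φ N y = 0) ∧ (∀ (N : ℕ) y, φ N y ≤ C * ((N : ℝ) + 1) ^ (3 * γ)) ∧ (∀ (N : ℕ) y, ‖Literature.Analysis.FunctionSpaces.Torus.gradient (φ N) y‖ ≤ C * ((N : ℝ) + 1) ^ (4 * γ))) → let ρb := fun (N : ℕ) (z : Literature.Analysis.FluidPDE.Config (N + 1) (Fin 3) (UnitAddTorus (Fin 3))) (x : (UnitAddTorus (Fin 3))) => Literature.MathematicalPhysics.KineticTheory.empiricalDensityField z (fun y => φ N (y - x)); let mb := fun (N : ℕ) (z : Literature.Analysis.FluidPDE.Config (N + 1) (Fin 3) (UnitAddTorus (Fin 3))) (x : (UnitAddTorus (Fin 3))) => Literature.MathematicalPhysics.KineticTheory.empiricalMomentumField z (fun y => φ N (y - x)); let ub := fun (N : ℕ)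 (z : Literature.Analysis.FluidPDE.Config (N + 1) (Fin 3) (UnitAddTorus (Fin 3))) (x : (UnitAddTorus (Fin 3))) => (ρb N z x)⁻¹ • mb N z x; let D := fun (N : ℕ) (z : Literature.Analysis.FluidPDE.Config (N + 1) (Fin 3) (UnitAddTorus (Fin 3))) (x : (UnitAddTorus (Fin 3))) (j k : Fin 3) => (∫ y, φ N (y.1 - x) * ((y.2 j - ub N z x j) * (y.2 k - ub N z x k)) ∂(Literature.Analysis.FluidPDE.empiricalMeasure z)) - (if j = k then (∑ l : Fin 3, ∫ y, φ N (y.1 - x) * (y.2 l - ub N z x l) ^ 2 ∂(Literature.Analysis.FluidPDE.empiricalMeasure z)) / 3 else 0); let q := fun (N : ℕ) (z : Literature.Analysis.FluidPDE.Config (N + 1) (Fin 3) (UnitAddTorus (Fin 3))) (x : (UnitAddTorus (Fin 3))) => ∫ y, (φ N (y.1 - x) * ‖y.2 - ub N z x‖ ^ 2 / 2) • (y.2 - ub N z x) ∂(Literature.Analysis.FluidPDE.empiricalMeasure z); ∀ t : ℝ, 0 < t → ∀ δ : ℝ, 0 < δ → Tendsto (fun N : ℕ => Literature.MathematicalPhysics.KineticTheory.localGibbsLaw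 σ a₀ u₀ θ₀ N (Φ N) {z | δ < ∫ s in Icc 0 t, ∫ x, ((∑ j, ∑ k, D N ((Φ N).flow s z) x j k ^ 2) + ‖q N ((Φ N).flow s z) x‖ ^ 2)}) atTop (𝓝 0)

/-- **`0 < σ` is load-bearing (the free gas does not relax).**  Witness: `σ = 0`, `Φ N = freeFlow₀ N`,
`a₀ = θ₀ = 1`, `u₀ x = U sin(2π x₂) e₁` (`U = 4`), the torus-mollifier kernel family (`γ = 1/15`), `t = 3`.
Proof plan (see §2a–§2d for the checked pieces):
(i) `I(z) ≥ ∫₀ᵗ (∫ₓ D₁₁)² ≥ L²/t`, `L = ∫₀ᵗ∫ₓ D₁₁` (Jensen on `𝕋³`, Cauchy–Schwarz on `[0,t]`);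
(ii) `∫ₓ D₁₁(Φ_s z, x) dx ≥ A(z) - ⅔ R(s, z)` with `A = ⅔T₁₁ - ⅓(T₂₂+T₃₃)` conserved by free flight and
`R(s,z) = ∫ₓ m̄₁²/ρ̄` (`integral_D11_ge`);
(iii) at time `s` the law of `(xᵢ(s), ξᵢ)` is uniform ⊗ standard Gaussian, i.i.d. (skew-translation invariance
of Haar measure), with `vᵢ₁ = ξᵢ₁ + U sin(2π(xᵢ₂(s) - s ξᵢ₂))`; conditioning on positions,
`E R(s) ≤ U² e^{-4π²s²} + (1 + U²) sup φ_N/(N+1)` (pair factorisation + `E cos(2πsξ) = e^{-2π²s²}`), while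
`E A = U²/3`, `E A² ≤ E|v|⁴ < ∞`;
(iv) second-moment lower bound `P(tA - ⅔∫R > m/2) ≥ m²/(4t²K)` uniformly in `N`, so the probabilities of
`{I > m²/(8t)}` do not tend to `0`.  OBSTRUCTION to closing now: volume of measure-theoretic bookkeeping
((iii) as a `Measure.map` identity on `Config (N+1)`; joint measurability of the observable in `(s, x)`), in
progress in the seat's work files. [folklore] -/
theorem fastMomentRelaxation_false_without_sigma_pos : ¬ FastMomentRelaxationWithoutSigmaPos := by
  sorry

end Summit.AtomisticToContinuum.HydrodynamicLimit.Cruxes.FastMomentRelaxation.Disproof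

end
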